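import Summits.CriticalPhenomena.SAWScalingLimit.Theses.SAWDefectDecoherence
import Literature.Probability.RandomPlanarGeometry.ConformalMap

/-!
# Negative knowledge on crux `HexObservableLimitR` (stmt-CriticalPhenomena-14003), part 8:
MUTATION — the normalisation `Φ → 0` at `b` is REDUNDANT

`hexObservableLimitR_iff_without_normaliserValue`: the repaired target is EQUIVALENT to the same statement with the
hypothesis `Φ.HasBoundaryValue (D.pt 1) 0` deleted.  Reason: the other hypotheses already force a finite REAL
boundary value `μ` of `Φ` at `b = pt 1` (`exists_real_boundaryValue`: near `b` the domain is the convex piece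
`{im z > im b} ∩ ball b ρ`, `Φ' = e^{L}` is bounded there because `L → L_b`, so `Φ` is Lipschitz (mean value
inequality), hence Cauchy along `𝓝[Ω] b`; the limit cannot lie in `ℍ = Φ(Ω)` by continuity of `Φ⁻¹` since
`b ∉ Ω`), and `Φ - μ` (`shift Φ μ`) is again a conformal equivalence `Ω → ℍ` with the same derivative, the same
pole at the root, and boundary value `0` at `b`; the conclusion only sees `L = log Φ'`.
Reading for provers / planners: the `b ↦ 0` clause of DCS's "`φ` maps `a` to `∞` and `b` to `0`" is cosmetic in
this frame (the density is `(Φ'/Φ'(b))^{5/8}`); what pins `b` is `L → L_b` plus the lattice pin.  No Theses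
statement is asserted.  Everything proved. [folklore]
-/

noncomputable section

open Set Filter Topology Complex Metric
open Literature.Probability.RandomPlanarGeometry
open UpperHalfPlane (upperHalfPlaneSet)
open Literature.Probability.LatticeModels Literature.Probability.RandomPlanarGeometry.SAW

namespace Summit.CriticalPhenomena.SAWScalingLimit.Theorems.HexObservableLimitR.Negative

open Summit.CriticalPhenomena.SAWScalingLimit.Theses.SAWDefectDecoherence

/-! ### Shifting a uniformiser by a real constant -/

/-- **`Φ - μ` for real `μ`**: again a conformal equivalence onto the upper half-plane. [folklore] -/
def shift {U : Set ℂ} (Φ : ConformalEquiv U upperHalfPlaneSet) (μ : ℝ) : ConformalEquiv U upperHalfPlaneSet where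
  toFun z := Φ z - μ
  invFun w := Φ.symm (w + μ)
  source := U
  target := upperHalfPlaneSet
  map_source' z hz := by
    have h : 0 < (Φ z).im := Φ.mapsTo hz
    show 0 < (Φ z - μ).im
    simpa using h
  map_target' w hw := by
    change 0 < w.im at hw
    have h : w + μ ∈ upperHalfPlaneSet := by show 0 < (w + (μ : ℂ)).im; simpa using hw
    exact Φ.symm.mapsTo h
  left_inv' z hz := by
    show Φ.symm (Φ z - μ + μ) = z
    rw [sub_add_cancel, Φ.symm_apply_apply hz]
  right_inv' w hw := by
    change 0 < w.im at hw
    have h : w + μ ∈ upperHalfPlaneSet := by show 0 < (w + (μ : ℂ)).im; simpa using hw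
    show Φ (Φ.symm (w + μ)) - μ = w
    rw [Φ.apply_symm_apply h, add_sub_cancel_right]
  source_eq := rfl
  target_eq := rfl
  differentiableOn := Φ.differentiableOn.sub_const _
  differentiableOn_symm := by
    refine Φ.symm.differentiableOn.comp (differentiableOn_id.add_const _) fun w hw => ?_
    change 0 < w.im at hw
    show 0 < (w + (μ : ℂ)).im
    simpa using hw

/-- `shift Φ μ z = Φ z - μ`. [folklore] -/
@[simp] theorem shift_apply {U : Set ℂ} (Φ : ConformalEquiv U upperHalfPlaneSet) (μ : ℝ) (z : ℂ) :
    shift Φ μ z = Φ z - μ := rfl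

/-- The shift has the same derivative. [folklore] -/
theorem deriv_shift {U : Set ℂ} (Φ : ConformalEquiv U upperHalfPlaneSet) (μ : ℝ) (z : ℂ) :
    deriv (shift Φ μ) z = deriv Φ z := by
  show deriv (fun z => Φ z - μ) z = deriv Φ z
  exact deriv_sub_const _

/-! ### The boundary value at the normaliser exists and is real -/

/-- **Existence of a real boundary value at a flat, log-regular boundary point.**  If `Ω` is the upper half-plane
near `b ∈ ∂Ω` (inside `ball b ρ`), `Φ : Ω ≃ ℍ` is conformal and `log Φ' = L → L_b` at `b` within `Ω`, then
`Φ z → μ` as `z → b` within `Ω` for some real `μ`. [folklore] -/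
theorem exists_real_boundaryValue (D : DobrushinDomain) {ρ : ℝ} (hρ : 0 < ρ)
    (hflat : D.carrier ∩ ball (D.pt 1) ρ = {z : ℂ | (D.pt 1).im < z.im} ∩ ball (D.pt 1) ρ)
    (Φ : ConformalEquiv D.carrier upperHalfPlaneSet) {L : ℂ → ℂ} {Lb : ℂ}
    (hexp : ∀ z ∈ D.carrier, Complex.exp (L z) = deriv Φ z)
    (hLb : Tendsto L (𝓝[D.carrier] (D.pt 1)) (𝓝 Lb)) :
    ∃ μ : ℝ, Φ.HasBoundaryValue (D.pt 1) μ := by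
  set b := D.pt 1 with hb
  -- (a) `L` is within `1` of `L_b` on `Ω ∩ ball b ρ₁`
  obtain ⟨ρ₁, hρ₁, hL1⟩ : ∃ ρ₁ > 0, ∀ z ∈ D.carrier, dist z b < ρ₁ → ‖L z - Lb‖ < 1 := by
    have h := Metric.tendsto_nhds.1 hLb 1 one_pos
    rw [eventually_nhdsWithin_iff, Metric.eventually_nhds_iff] at h
    obtain ⟨ε, hε, h⟩ := h
    exact ⟨ε, hε, fun z hz hd => by simpa [dist_eq_norm] using h hd hz⟩
  set ρ₂ := min ρ ρ₁ with hρ₂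
  have hρ₂0 : 0 < ρ₂ := lt_min hρ hρ₁
  set S := D.carrier ∩ ball b ρ₂ with hS
  have hSeq : S = {z : ℂ | b.im < z.im} ∩ ball b ρ₂ := by
    ext z
    constructor
    · rintro ⟨hz, hd⟩
      have : z ∈ D.carrier ∩ ball b ρ := ⟨hz, ball_subset_ball (min_le_left _ _) hd⟩
      rw [hflat] at this
      exact ⟨this.1, hd⟩
    · rintro ⟨hz, hd⟩
      have : z ∈ {z : ℂ | b.im < z.im} ∩ ball b ρ := ⟨hz, ball_subset_ball (min_le_left _ _) hd⟩
      rw [← hflat] at this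
      exact ⟨this.1, hd⟩
  have hSconv : Convex ℝ S := by rw [hSeq]; exact (convex_halfSpace_im_gt _).inter (convex_ball _ _)
  have hSD : S ⊆ D.carrier := inter_subset_left
  -- (b) the derivative is bounded by `M = e^{re L_b + 1}` on `S`
  set M := Real.exp (Lb.re + 1) with hM
  have hMpos : 0 < M := Real.exp_pos _
  have hbound : ∀ z ∈ S, ‖deriv Φ z‖ ≤ M := by
    rintro z ⟨hz, hd⟩
    rw [← hexp z hz, Complex.norm_exp]
    refine Real.exp_le_exp.2 ?_
    have h1 := hL1 z hz (lt_of_lt_of_le (mem_ball.1 hd) (min_le_right _ _))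
    have h2 : |(L z - Lb).re| ≤ ‖L z - Lb‖ := Complex.abs_re_le_norm _
    rw [Complex.sub_re] at h2
    have h3 := (abs_le.1 h2).2
    linarith
  have hdiff : ∀ z ∈ S, DifferentiableAt ℂ Φ z := fun z hz =>
    Φ.differentiableOn.differentiableAt (D.isOpen.mem_nhds (hSD hz))
  have hlip : ∀ p ∈ S, ∀ q ∈ S, ‖Φ q - Φ p‖ ≤ M * ‖q - p‖ := fun p hp q hq =>
    hSconv.norm_image_sub_le_of_norm_deriv_le hdiff hbound hp hq
  -- (c) `b ∈ closure S`, so `𝓝[S] b` is non-trivial, and `𝓝[S] b = 𝓝[Ω] b`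
  have hbS : b ∈ closure S := by
    refine mem_closure_of_tendsto
      (f := fun t : ℝ => b + (t : ℂ) * Complex.I) (b := 𝓝[>] (0 : ℝ)) ?_ ?_
    · have : Continuous fun t : ℝ => b + (t : ℂ) * Complex.I := by fun_prop
      simpa using (this.tendsto' 0 b (by simp)).mono_left nhdsWithin_le_nhds
    · filter_upwards [Ioo_mem_nhdsGT hρ₂0] with t ht
      rw [hSeq]
      refine ⟨by simpa using ht.1, ?_⟩
      rw [mem_ball, dist_eq_norm]
      simpa [abs_of_pos ht.1] using ht.2
  haveI hne : (𝓝[S] b).NeBot := mem_closure_iff_nhdsWithin_neBot.1 hbS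
  have hSD' : 𝓝[S] b = 𝓝[D.carrier] b := by
    rw [hS, inter_comm]
    exact nhdsWithin_inter_of_mem (mem_nhdsWithin_of_mem_nhds (ball_mem_nhds b hρ₂0))
  -- (d) `Φ` is Cauchy along `𝓝[S] b`
  have hC : Cauchy ((𝓝[S] b).map Φ) := by
    rw [Metric.cauchy_iff]
    refine ⟨inferInstance, fun ε hε => ?_⟩
    set r := ε / (4 * M) with hr
    have hr0 : 0 < r := by positivity
    refine ⟨Φ '' (S ∩ ball b r), image_mem_map (inter_mem_nhdsWithin S (ball_mem_nhds b hr0)), ?_⟩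
    rintro x ⟨p, ⟨hpS, hpr⟩, rfl⟩ y ⟨q, ⟨hqS, hqr⟩, rfl⟩
    rw [dist_eq_norm]
    have h1 := hlip q hqS p hpS
    have h2 : ‖p - q‖ ≤ ‖p - b‖ + ‖b - q‖ := norm_sub_le_norm_sub_add_norm_sub _ _ _
    rw [mem_ball, dist_eq_norm] at hpr hqr
    rw [norm_sub_rev] at hqr
    calc ‖Φ p - Φ q‖ ≤ M * ‖p - q‖ := h1
      _ ≤ M * (r + r) := by gcongr; linarith
      _ = ε / 2 := by rw [hr]; field_simp; ring
      _ < ε := by linarith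
  obtain ⟨μ, hμ⟩ := cauchy_map_iff_exists_tendsto.1 hC
  rw [hSD'] at hμ
  haveI hneD : (𝓝[D.carrier] b).NeBot := by rw [← hSD']; exact hne
  -- (e) the limit is real: `im μ ≥ 0`, and `im μ > 0` would put `b` inside `Ω`
  have him0 : 0 ≤ μ.im := by
    have h := (Complex.continuous_im.tendsto μ).comp hμ
    exact ge_of_tendsto h (eventually_nhdsWithin_of_forall fun z hz => (show 0 < (Φ z).im from Φ.mapsTo hz).le)
  have him : μ.im = 0 := by
    by_contra hne'
    have hpos : 0 < μ.im := lt_of_le_of_ne him0 (Ne.symm hne')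
    have hμH : μ ∈ upperHalfPlaneSet := hpos
    -- `Φ⁻¹` is continuous at `μ`, so `z = Φ⁻¹ (Φ z) → Φ⁻¹ μ` along `𝓝[Ω] b`; but `z → b ∉ Ω`
    have hcont : ContinuousAt Φ.symm μ :=
      (Φ.symm.differentiableOn.differentiableAt (UpperHalfPlane.isOpen_upperHalfPlaneSet.mem_nhds hμH)).continuousAt
    have h1 : Tendsto (fun z => Φ.symm (Φ z)) (𝓝[D.carrier] b) (𝓝 (Φ.symm μ)) := hcont.tendsto.comp hμ
    have h2 : Tendsto (fun z => Φ.symm (Φ z)) (𝓝[D.carrier] b) (𝓝 b) :=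
      (tendsto_nhdsWithin_of_tendsto_nhds tendsto_id).congr' (eventually_nhdsWithin_of_forall fun z hz =>
        (Φ.symm_apply_apply hz).symm) |>.mono_left le_rfl
    have hbeq : Φ.symm μ = b := tendsto_nhds_unique h1 h2
    have hbD : b ∈ D.carrier := hbeq ▸ Φ.symm.mapsTo hμH
    have hbfr : b ∈ frontier D.carrier := D.boundary_mem_frontier _
    exact hbfr.2 (by rw [D.isOpen.interior_eq]; exact hbD)
  refine ⟨μ.re, ?_⟩
  unfold ConformalEquiv.HasBoundaryValue
  convert hμ using 2
  exact Complex.ext (by simp) (by simp [him])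

/-! ### The equivalence -/

/-- **`HexObservableLimitR` is equivalent to its version without `Φ → 0` at `b`.** [folklore] -/
theorem hexObservableLimitR_iff_without_normaliserValue : HexObservableLimitR ↔ ∃ c : ℂ, c ≠ 0 ∧
    ∀ (D : Literature.Probability.RandomPlanarGeometry.DobrushinDomain) (ρ : ℝ)
      (Λ : ℝ → Finset Literature.Probability.LatticeModels.HexVertex) (m : Fin 2 → ℝ → ℤ)
      (a b : ℝ → Sym2 Literature.Probability.LatticeModels.HexVertex)
      (Φ : Literature.Probability.RandomPlanarGeometry.ConformalEquiv D.carrier UpperHalfPlane.upperHalfPlaneSet)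
      (L : ℂ → ℂ) (Lb : ℂ) (ψ : ℂ → ℂ),
      let F : ℝ → Sym2 Literature.Probability.LatticeModels.HexVertex → ℂ := fun δ z =>
        Literature.Probability.RandomPlanarGeometry.SAW.hexParafermionicObservable (Λ δ) (a δ)
          Literature.Probability.RandomPlanarGeometry.SAW.hexCriticalFugacity (5 / 8) z
      0 < ρ → (∀ i : Fin 2, D.carrier ∩ Metric.ball (D.pt i) ρ = {z : ℂ | (D.pt i).im < z.im} ∩ Metric.ball (D.pt i) ρ) →
      (∀ᶠ δ : ℝ in nhdsWithin 0 (Set.Ioi 0),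
        Literature.Probability.RandomPlanarGeometry.SAW.hexDomainSimplyConnected (Λ δ) ∧
        a δ ∈ Literature.Probability.RandomPlanarGeometry.SAW.hexDomainBoundary (Λ δ) ∧
        b δ ∈ Literature.Probability.RandomPlanarGeometry.SAW.hexDomainBoundary (Λ δ) ∧
        Nonempty (Literature.Probability.RandomPlanarGeometry.SAW.HexMidEdgeSAW (Λ δ) (a δ) (b δ)) ∧
        (Literature.Probability.LatticeModels.hexGraph.induce ((Λ δ : Finset
          Literature.Probability.LatticeModels.HexVertex) : Set
          Literature.Probability.LatticeModels.HexVertex)).Preconnected ∧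
        (∀ v ∈ Λ δ, (δ : ℂ) * Literature.Probability.LatticeModels.hexCenter v ∈ D.carrier) ∧
        (∀ i : Fin 2, ∀ v : Literature.Probability.LatticeModels.HexVertex, (δ : ℂ) *
          Literature.Probability.LatticeModels.hexCenter v ∈ Metric.ball (D.pt i) ρ → (v ∈ Λ δ ↔ m i δ ≤ v.1 1))) →
      (∀ K : Set ℂ, IsCompact K → K ⊆ D.carrier → ∀ᶠ δ : ℝ in nhdsWithin 0 (Set.Ioi 0), ∀ v :
        Literature.Probability.LatticeModels.HexVertex, (δ : ℂ) *
        Literature.Probability.LatticeModels.hexCenter v ∈ K → v ∈ Λ δ) →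
      Filter.Tendsto (fun δ : ℝ => (δ : ℂ) * Literature.Probability.RandomPlanarGeometry.SAW.hexMidpoint (a δ))
        (nhdsWithin 0 (Set.Ioi 0)) (nhds (D.pt 0)) →
      Filter.Tendsto (fun δ : ℝ => (δ : ℂ) * Literature.Probability.RandomPlanarGeometry.SAW.hexMidpoint (b δ))
        (nhdsWithin 0 (Set.Ioi 0)) (nhds (D.pt 1)) →
      Filter.Tendsto (fun x => ‖Φ x‖) (nhdsWithin (D.pt 0) D.carrier) Filter.atTop →
      ContinuousOn L D.carrier → (∀ z ∈ D.carrier, Complex.exp (L z) = deriv Φ z) →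
      Filter.Tendsto L (nhdsWithin (D.pt 1) D.carrier) (nhds Lb) → Continuous ψ → HasCompactSupport ψ →
      tsupport ψ ⊆ D.carrier →
      Filter.Tendsto (fun δ : ℝ => (δ : ℂ) ^ 2 * (∑ᶠ e ∈
        Literature.Probability.RandomPlanarGeometry.SAW.hexDomainMidEdges (Λ δ), ψ ((δ : ℂ) *
        Literature.Probability.RandomPlanarGeometry.SAW.hexMidpoint e) * F δ e) / F δ (b δ))
        (nhdsWithin 0 (Set.Ioi 0)) (nhds (c * ∫ z, ψ z * Complex.exp ((5 / 8 : ℂ) * (L z - Lb)))) := by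
  constructor
  · rintro ⟨c, hc, H⟩
    refine ⟨c, hc, fun D ρ Λ m a b Φ L Lb ψ hρ hflat hev hK ha hb hΦ hL hexp hLb hψc hψK hψD => ?_⟩
    -- the boundary value at `pt 1` exists and is real; shift it away
    obtain ⟨μ, hμ⟩ := exists_real_boundaryValue D hρ (hflat 1) Φ hexp hLb
    have H' := H D ρ Λ m a b (shift Φ μ) L Lb ψ hρ hflat hev hK ha hb ?_ ?_ hL
      (fun z hz => by rw [deriv_shift]; exact hexp z hz) hLb hψc hψK hψD
    · exact H'
    · -- the pole at the root survives the shift: `‖Φ - μ‖ ≥ ‖Φ‖ - |μ|`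
      have h1 : Tendsto (fun x => ‖Φ x‖ - ‖(μ : ℂ)‖) (𝓝[D.carrier] (D.pt 0)) atTop :=
        tendsto_atTop_add_const_right _ _ hΦ
      refine tendsto_atTop_mono (fun x => ?_) h1
      show ‖Φ x‖ - ‖(μ : ℂ)‖ ≤ ‖Φ x - μ‖
      linarith [norm_sub_norm_le (Φ x) (μ : ℂ)]
    · -- boundary value `0` at `pt 1`
      unfold ConformalEquiv.HasBoundaryValue at hμ ⊢
      have := hμ.sub_const (μ : ℂ)
      change Tendsto (fun x => Φ x - μ) _ _
      simpa using this
  · rintro ⟨c, hc, H⟩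
    exact ⟨c, hc, fun D ρ Λ m a b Φ L Lb ψ hρ hflat hev hK ha hb hΦ _ hL hexp hLb hψc hψK hψD =>
      H D ρ Λ m a b Φ L Lb ψ hρ hflat hev hK ha hb hΦ hL hexp hLb hψc hψK hψD⟩

end Summit.CriticalPhenomena.SAWScalingLimit.Theorems.HexObservableLimitR.Negative
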